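/-
Copyright (c) 2026 the pub-hodgecm-mathlib formalisation cell (harness21).  Prover seat hodgecm-mathlib-K2E2-p12 (g10), Track B «K2-LIT», h413 = `stmt-HodgeConjecture-24833`,
route `HCCMUnconditional`; R90-TF section S8 «ContSpec-n½», ESTATE T PORTS (S8 dealer R90-CS-plan (g3), S8-R211 (2)), FILE 1 of 2: the `τ`-twins of ★ P1 `exists_entire_symbol_of_arch`
and ★ 7b-1 `exists_gauge_symbol_three`, HYPOTHESIS-FIRST on the 12d-C_τ per-`z` scalar letter, over a BARE section space `V` (census `CENSUS-GaugeSymbolTau.K2E2-p12-g10.md`).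
FILE 2 `K2E1ChiGaugeSymbolTauCMThree`: the CM heads in ★ `exists_chi_convData_cm_three`'s `hfam`∕`hnc` currency and the read-backs.
-/
import Summits.HodgeConjecture.HodgeConjecture.Theorems.K2E1ArchSymbolCirclePhaseU3     -- ★ 7b-1 (`N = 3`): ray₃ `exists_mem_borelHeight_archToAdelic_ne_one_three`; brings ★ P1, ★ 2c-A `K2E1ArchSymbolFormulaU2`, ★ 2a∕2b, the ★ engines, ★ 12d-C
import HarnessLib

/-!
# h413 ∕ R90-S8 ESTATE T — `K2E1ChiGaugeSymbolTauU3` (FILE 1): THE ARCHIMEDEAN GAUGE SYMBOL ON A BARE SECTION SPACE `V`, FROM THE PER-`z` SCALAR LETTER (the `τ`-twins of ★ P1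
# `exists_entire_symbol_of_arch` and ★ 7b-1 `exists_gauge_symbol_three`)

Cell `pub/hodgecm-mathlib`, crux H413 = `stmt-HodgeConjecture-24833`, route `HCCMUnconditional`; R90-TF section S8 «ContSpec-n½», ESTATE T (S8-R199 J-S8-ADM′, S8-R208 J-S8-T2,
S8-R211 (2)).  THEOREMS ONLY (no `def`, no `instance`, no notation, no named-fact hypothesis, no `sorry`; `maxHeartbeats 400000` on the core exactly as ★ 7b-1); lane
`--supports stmt-HodgeConjecture-24833 --as helper` (count-neutral).  Closes no socket.  Generic quadratic datum `(F, E, c)`; §1–§2 every rank `N`, §3 at `N = 3` (the archimedean ray).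

THE MATHEMATICS ([Bump1997] proof of Lemma 2.3.2; [BernsteinLapid2019] §4 Claims 1–2; [Langlands1976] §6; K2E1-p11 (g5)'s ESTATE T census cc10c33dbec127a5 (1)–(3)).  The row-8 exports of
the χ-Eisenstein engine are INDEX-FREE over a bare `V : Submodule ℂ (G(𝔸) → ℂ)`; the ONLY place where the one-dimensional `K_∞`-type `ω` enters is the letter pair `hfam`∕`hnc` of ★
`exists_chi_convData_cm_three`, paid at `V(χ, K′, ω)` by ★ 7b-1 ⟸ ★ P1 ⟸ ★ 12d-C ⟸ ★ 12d-I (the `(B_∞, c_z; K_∞, ω)`-slices form a LINE, so a `K_∞`-central pure tensor `h_∞ ⊗ 𝟙_U` acts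
on every `f_z^φ` by ONE scalar).  For a block of PURE `K_∞`-type `τ` (ESTATE T) the line is the multiplicity-one line of ★ (α) `R90S8KTypeSliceLineU3` (K2E1-p14) and the scalar action is
12d-C_τ (K2E1-p15); everything downstream of the scalar — the entire symbol, the integral formula `s(z) = κμ_f(U)∫h_∞·Φ·R^z`, the phase-control neighbourhood giving `s(z₀) ≠ 0`, the
archimedean ray giving non-constancy — reads ONE scalar slice `Φ(a) = φ₀(k₀ιa)∕φ₀(k₀)` and is the SAME calculus.  This file is that calculus, HYPOTHESIS-FIRST on the per-`z` scalar letter and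
VOCABULARY-FREE in `V` (no `K′`, `ω`, `hKinf`, `hc`, `hfix`): the structural binders are `hVc` (continuity), `hVU` (right-invariance under the finite level `ι_f(U₀ ∩ G_f)`, `U₀ ≤ GL₃(𝒪̂)`
open compact) and `hVK` («a section vanishing on `K_max` vanishes» — the only place the Iwasawa decomposition ∕ the left Borel law enter; FILE 2 pays it for every `(χ₁, χ₂)`-pair-section).
* §0 `adelicVal_finAdelicToAdelic_mem_of_mem_glFiniteIntegralLevel` (`ι_f b ∈ K` for `b_f ∈ GL_N(𝒪̂)`).
* §1 P1_τ **`exists_entire_symbol_of_scalars`** (every `N`): per-`z` scalars `∀ z, ∃ s, ∀ φ ∈ V, ∀ x, ∫ h·f_z^φ(x·) = s·f_z^φ(x)` for `h ∈ C_c` and continuous `V` ⇒ ONE ENTIRE `s` (★ P1's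
  proof; entire by ★ row 10 `differentiable_rightConvSection_apply`).
* §2 2c-A_τ **`symbol_eq_integral_arch_of_rightInvariant`** (every `N`): `s z = κ·μ_f(U)·∫ h_∞(a)·Φ(a)·R(a)^z dμ_∞` for `V` right-invariant under `ι_f(U)`, `ι_f(U) ⊆ K`.
* §3 7b-1_τ CORE **`exists_gauge_symbol_of_scalars_three`** (`N = 3`): THE LETTER `h12dCτ` — «every `K_∞`-central pure tensor `h = h_∞ ⊗ 𝟙_{U₀∩G_f}` in `C_c(G(𝔸))` acts on `V ⊗ H^z` by
  per-`z` scalars» (`hten`∕`hcent` in ★ 12d-C's bytes) — ⊢ ★ 7b-1's conclusion with `chiSectionSpace χ K′ ω ↦ V`: a gauge test function `η_ψ = α_ψ ⊗ 𝟙_{U₀}` whose self-convolution has an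
  ENTIRE symbol `s` on `V`, `s(z₀) ≠ 0`, `s` NON-CONSTANT.
HONEST LABEL: HC_CM is proved only modulo the 7 printed citations (2 remaining named inputs: hLiu418 = `stmt-HodgeConjecture-24832`, h413 = `stmt-HodgeConjecture-24833`) until rung 0
closes; this file asserts no named fact and closes no socket; the letter `h12dCτ` (12d-C_τ, K2E1-p15) and the pure-type block (K2E1-p14 (α), K2E1-p12 laws) are NOT proved here; count-neutral.

## References
* [Bump1997] D. Bump, *Automorphic Forms and Representations* (1997), proof of Lemma 2.3.2.
* [BernsteinLapid2019] J. Bernstein, E. Lapid, *On the meromorphic continuation of Eisenstein series*, J. Amer. Math. Soc. 37 (2024) (arXiv:1911.02342), §4 Claims 1–2.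
* [Langlands1976] R. P. Langlands, *On the Functional Equations Satisfied by Eisenstein Series*, LNM 544 (1976), §6.
* [BorelJacquet1979] A. Borel, H. Jacquet, *Automorphic forms and automorphic representations*, Proc. Symp. Pure Math. 33.1 (1979), §4.1.
-/

set_option autoImplicit false
set_option linter.dupNamespace false  -- the mandated namespace repeats the summit's segment

noncomputable section

open MeasureTheory Measure NumberField NumberField.mixedEmbedding IsDedekindDomain Set Filter Topology
open scoped NNReal MatrixGroups Classical Pointwise
open Literature.NumberTheory Literature.NumberTheory.Automorphic Literature.NumberTheory.Automorphic.UnitaryGroup AdelicGroupData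
open Literature.NumberTheory.GaloisRepresentations (HeckeCharacter)
open Summit.HodgeConjecture.HodgeConjecture.Cruxes.H413.K2E1BorelEisensteinU
open Summit.HodgeConjecture.HodgeConjecture.Cruxes.H413.K2E1CharacterEisensteinU2Defs
open Summit.HodgeConjecture.HodgeConjecture.Cruxes.H413.K2E1ChiSectionSpaceU2Defs
open Summit.HodgeConjecture.HodgeConjecture.Cruxes.H413.K2E1ArchPureTensorSelfConvolutionU2
open Summit.HodgeConjecture.HodgeConjecture.Cruxes.H413.K2E1ArchSymbolFormulaU2
open Summit.HodgeConjecture.HodgeConjecture.Cruxes.H413.K2E1ArchTestFunctionSymbolU2 (flatSectionU_ne_zero)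
open Summit.HodgeConjecture.HodgeConjecture.Cruxes.H413.K2E1ChiEisensteinHeckeMatrixU2 (differentiable_rightConvSection_apply)
open Summit.HodgeConjecture.HodgeConjecture.Cruxes.H413.K2E1SymbolPositivitySecondDifference (integral_ne_zero_of_re_ge_half exists_apply_ne_apply_of_secondDiff)
open Summit.HodgeConjecture.HodgeConjecture.Cruxes.H413.K2E1BLSelfConvolutionU2 (continuous_selfConv hasCompactSupport_selfConv)
open Summit.HodgeConjecture.HodgeConjecture.Cruxes.H413.K2E1ArchSymbolCirclePhaseU2 (exists_rOut_forall_support_subset mem_tsupport_mul_of_integral_ne_zero)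
open Summit.HodgeConjecture.HodgeConjecture.Cruxes.H413.K2E1ArchSymbolCirclePhaseU3 (exists_mem_borelHeight_archToAdelic_ne_one_three)
open Summit.HodgeConjecture.HodgeConjecture.Cruxes.H413.K2E1SphericalHeckeEigenSectionU2 (continuous_borelHeight_coe borelHeight_eq_one_of_mem)

namespace Summit.HodgeConjecture.HodgeConjecture.Cruxes.H413.K2E1ChiGaugeSymbolTauU3

/-! ## §0 `ι_f b ∈ K` for `b_f ∈ GL_N(𝒪̂_E)` -/

section Level

variable {F E : Type} [Field F] [NumberField F] [Field E] [NumberField E] [Algebra F E] {c : E ≃ₐ[F] E} {N : ℕ}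

/-- **`ι_f(b) ∈ K = val⁻¹(K_∞·GL_N(𝒪̂_E))`** for a finite-adelic `b` whose matrix lies in `GL_N(𝒪̂_E)` (★ `adelicVal_finAdelicToAdelic`, ★ `GLn.ofFinite_mem_glIntegralLevel`,
★ `glIntegralLevel_le_standardMaximalCompactGL`). [cite: BorelJacquet1979, §4.1] -/
theorem adelicVal_finAdelicToAdelic_mem_of_mem_glFiniteIntegralLevel {b : finAdelic F E c N ((StdForm.antidiagonal N).over E)}
    (hb : (b : GL (Fin N) (FiniteAdeleRing (𝓞 E) E)) ∈ glFiniteIntegralLevel N E) :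
    adelicVal F E c N ((StdForm.antidiagonal N).over E) (finAdelicToAdelic F E c N ((StdForm.antidiagonal N).over E) b) ∈ standardMaximalCompactGL N E := by
  rw [adelicVal_finAdelicToAdelic]
  exact glIntegralLevel_le_standardMaximalCompactGL (GLn.ofFinite_mem_glIntegralLevel hb)

end Level

/-! ## §1 P1_τ: per-`z` scalars ⇒ ONE ENTIRE symbol -/

section Entire

variable {F E : Type} [Field F] [NumberField F] [Field E] [NumberField E] [Algebra F E] {c : E ≃ₐ[F] E} {N : ℕ} [NeZero N]
variable [MeasurableSpace (quasiSplit F E c N).Adelic] [BorelSpace (quasiSplit F E c N).Adelic]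
variable (νG : Measure (quasiSplit F E c N).Adelic) [νG.IsHaarMeasure]

/-- **P1_τ — THE SCALAR OF A TEST FUNCTION ON A SECTION SPACE IS ONE ENTIRE SYMBOL**: let `h ∈ C_c(G(𝔸))` and let `V` be a space of CONTINUOUS functions on `G(𝔸)` such that for EVERY
`z` there is a scalar `s_z` with `∫_G h(y)·f_z^φ(x y) dν_G = s_z·f_z^φ(x)` for all `φ ∈ V`, all `x` (the per-`z` scalar letter: ★ 12d-C at `V(χ, K′, ω)`, 12d-C_τ at a pure-type block).
Then ONE ENTIRE `s : ℂ → ℂ` serves for all `z`: `s z = (R(h)f_z^{φ₀})(x₀)·H(x₀)^{−z}∕φ₀(x₀)` at any non-vanishing value (entire by ★ row 10 `differentiable_rightConvSection_apply`), `s ≡ 1`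
if `V` has none (★ P1's proof verbatim, the letter in place of ★ 12d-C). [cite: BernsteinLapid2019, §4 Claim 1] [cite: Langlands1976, §6 (p. 167)] -/
theorem exists_entire_symbol_of_scalars {h : (quasiSplit F E c N).Adelic → ℂ} (hh : Continuous h) (hhs : HasCompactSupport h)
    {V : Submodule ℂ ((quasiSplit F E c N).Adelic → ℂ)} (hVc : ∀ φ ∈ V, Continuous φ)
    (hs : ∀ z : ℂ, ∃ s : ℂ, ∀ φ ∈ V, ∀ x : (quasiSplit F E c N).Adelic, ∫ y, h y * flatSectionU φ z (x * y) ∂νG = s * flatSectionU φ z x) :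
    ∃ s : ℂ → ℂ, Differentiable ℂ s ∧ ∀ (z : ℂ), ∀ φ ∈ V, ∀ x : (quasiSplit F E c N).Adelic,
      ∫ y, h y * flatSectionU φ z (x * y) ∂νG = s z * flatSectionU φ z x := by
  choose s hs using hs
  by_cases hV : ∃ φ₀ ∈ V, ∃ x₀ : (quasiSplit F E c N).Adelic, φ₀ x₀ ≠ 0
  · obtain ⟨φ₀, hφ₀, x₀, hx₀⟩ := hV
    have hne : (((borelHeight x₀ : ℝ≥0) : ℝ) : ℂ) ≠ 0 := Complex.ofReal_ne_zero.2 (ne_of_gt (by exact_mod_cast borelHeight_pos x₀))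
    -- `s z = (R(h) f_z^{φ₀})(x₀)·H(x₀)^{−z} ∕ φ₀(x₀)`, an entire function of `z`
    have hsz : ∀ z, s z = ((∫ y, h y * flatSectionU φ₀ z (x₀ * y) ∂νG) * (((borelHeight x₀ : ℝ≥0) : ℝ) : ℂ) ^ (-z)) / φ₀ x₀ := fun z => by
      rw [hs z φ₀ hφ₀ x₀, flatSectionU_apply, eq_div_iff hx₀, mul_assoc, mul_assoc, ← Complex.cpow_add _ _ hne, add_neg_cancel, Complex.cpow_zero, mul_one]
    refine ⟨s, ?_, hs⟩
    rw [show s = fun z => ((∫ y, h y * flatSectionU φ₀ z (x₀ * y) ∂νG) * (((borelHeight x₀ : ℝ≥0) : ℝ) : ℂ) ^ (-z)) / φ₀ x₀ from funext hsz]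
    exact (differentiable_rightConvSection_apply νG hh hhs (hVc φ₀ hφ₀) x₀).div_const _
  · -- no member of `V` has a non-zero value: every `φ ∈ V` is `0`, and `s ≡ 1` serves
    push Not at hV
    refine ⟨fun _ => 1, differentiable_const 1, fun z φ hφ x => ?_⟩
    have hφ0 : φ = 0 := funext fun y => hV φ hφ y
    subst hφ0
    have h0 : ∀ y, flatSectionU (0 : (quasiSplit F E c N).Adelic → ℂ) z y = 0 := fun y => by rw [flatSectionU_apply, Pi.zero_apply, zero_mul]
    simp only [h0, mul_zero, integral_zero]

end Entire

/-! ## §2 2c-A_τ: the integral formula of the symbol for a right-`ι_f(U)`-invariant section space -/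

section Formula

variable {F E : Type} [Field F] [NumberField F] [Field E] [NumberField E] [Algebra F E] {c : E ≃ₐ[F] E} {N : ℕ} [NeZero N]
variable [MeasurableSpace (quasiSplit F E c N).Adelic] [BorelSpace (quasiSplit F E c N).Adelic]
variable [MeasurableSpace (arch F E c N ((StdForm.antidiagonal N).over E))] [BorelSpace (arch F E c N ((StdForm.antidiagonal N).over E))]
variable [MeasurableSpace (finAdelic F E c N ((StdForm.antidiagonal N).over E))] [BorelSpace (finAdelic F E c N ((StdForm.antidiagonal N).over E))]
variable (νG : Measure (quasiSplit F E c N).Adelic) [νG.IsHaarMeasure]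
variable (μa : Measure (arch F E c N ((StdForm.antidiagonal N).over E))) [μa.IsHaarMeasure]
variable (μf : Measure (finAdelic F E c N ((StdForm.antidiagonal N).over E))) [μf.IsHaarMeasure]

/-- **2c-A_τ — THE INTEGRAL FORMULA OF THE SYMBOL ON A RIGHT-`ι_f(U)`-INVARIANT SECTION SPACE**: let `h = h_∞ ⊗ 𝟙_U` be a pure tensor (`hten`, `U ⊆ G(𝔸_f)` measurable with `ι_f(U) ⊆ K`), let
every `φ ∈ V` be right-invariant under `ι_f(U)` (`hVU`), and suppose `s` satisfies the action clause on `V`.  Then for every `φ₀ ∈ V`, `x₀` with `φ₀(x₀) ≠ 0`, with the universal `κ > 0`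
of ★ `exists_integral_pureTensor_mul_eq_arch`: `s z = κ·μ_f(U)·∫_{G_∞} h_∞(a)·(Φ(a)·R(a)^z) dμ_∞`, `Φ(a) := φ₀(x₀ ι a)∕φ₀(x₀)`, `R(a) := H(x₀ ι a)∕H(x₀)` (★ 2c-A's proof; the
right-`U`-invariance of `f_z^{φ₀}(x₀·)` from `hVU` and `H(y·ι_f b) = H(y)`, ★ `borelHeight_mul_of_mem_comap_standardMaximalCompactGL`). [cite: BernsteinLapid2019, §4 Claim 1]
[cite: BorelJacquet1979, §4.1] -/
theorem symbol_eq_integral_arch_of_rightInvariant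
    {h : (quasiSplit F E c N).Adelic → ℂ} {hinf : arch F E c N ((StdForm.antidiagonal N).over E) → ℂ} {U : Set (finAdelic F E c N ((StdForm.antidiagonal N).over E))}
    (hUm : MeasurableSet U) (hten : ∀ y, h y = hinf (archPart F E c N _ y) * U.indicator (fun _ => (1 : ℂ)) (finPart F E c N _ y))
    (hUK : ∀ b ∈ U, adelicVal F E c N ((StdForm.antidiagonal N).over E) (finAdelicToAdelic F E c N ((StdForm.antidiagonal N).over E) b) ∈ standardMaximalCompactGL N E)
    {V : Submodule ℂ ((quasiSplit F E c N).Adelic → ℂ)}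
    (hVU : ∀ φ ∈ V, ∀ b ∈ U, ∀ y : (quasiSplit F E c N).Adelic, φ (y * finAdelicToAdelic F E c N ((StdForm.antidiagonal N).over E) b) = φ y)
    {s : ℂ → ℂ} (hs : ∀ z : ℂ, ∀ φ ∈ V, ∀ x : (quasiSplit F E c N).Adelic, ∫ y, h y * flatSectionU φ z (x * y) ∂νG = s z * flatSectionU φ z x)
    {φ₀ : (quasiSplit F E c N).Adelic → ℂ} (hφ₀ : φ₀ ∈ V) {x₀ : (quasiSplit F E c N).Adelic} (hx₀ : φ₀ x₀ ≠ 0) :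
    ∃ κ : ℝ≥0, 0 < κ ∧ ∀ z : ℂ, s z = ((κ : ℝ) : ℂ) * (μf.real U : ℂ) *
      ∫ a, hinf a * ((φ₀ (x₀ * archToAdelic F E c N _ a) / φ₀ x₀) *
        ((((((borelHeight (x₀ * archToAdelic F E c N _ a) : ℝ≥0) : ℝ) / ((borelHeight x₀ : ℝ≥0) : ℝ) : ℝ)) : ℂ) ^ z)) ∂μa := by
  obtain ⟨κ, hκ, hF⟩ := exists_integral_pureTensor_mul_eq_arch νG μa μf
  refine ⟨κ, hκ, fun z => ?_⟩
  have hne : flatSectionU φ₀ z x₀ ≠ 0 := flatSectionU_ne_zero hx₀ z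
  -- `F = f_z^{φ₀}(x₀ ·)` is right-`ι_f(U)`-invariant
  have hF' : ∀ y, ∀ b ∈ U, flatSectionU φ₀ z (x₀ * (y * finAdelicToAdelic F E c N _ b)) = flatSectionU φ₀ z (x₀ * y) := by
    intro y b hb
    rw [← mul_assoc, flatSectionU_apply, flatSectionU_apply, hVU φ₀ hφ₀ b hb, borelHeight_mul_of_mem_comap_standardMaximalCompactGL (Subgroup.mem_comap.2 (hUK b hb))]
  have e := hs z φ₀ hφ₀ x₀
  rw [hF h hinf U hUm hten (fun y => flatSectionU φ₀ z (x₀ * y)) hF'] at e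
  -- divide by `f_z^{φ₀}(x₀) ≠ 0`
  have e' : s z = ((κ : ℝ) : ℂ) * (μf.real U : ℂ) * (∫ a, hinf a * flatSectionU φ₀ z (x₀ * archToAdelic F E c N _ a) ∂μa) / flatSectionU φ₀ z x₀ := by
    rw [eq_div_iff hne]; exact e.symm
  rw [e', mul_div_assoc, ← integral_div]
  congr 1
  refine integral_congr_ae (Eventually.of_forall fun a => ?_)
  show hinf a * flatSectionU φ₀ z (x₀ * archToAdelic F E c N _ a) / flatSectionU φ₀ z x₀ = _
  rw [mul_div_assoc, flatSectionU_mul_div_eq]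

end Formula

/-! ## §3 7b-1_τ CORE (`N = 3`): a gauge test function whose symbol on `V` is entire, `≠ 0` at `z₀`, and non-constant — from the per-`z` scalar letter `h12dCτ` -/

section Core

variable {F E : Type} [Field F] [NumberField F] [Field E] [NumberField E] [Algebra F E] {c : E ≃ₐ[F] E}
variable [MeasurableSpace (quasiSplit F E c 3).Adelic] [BorelSpace (quasiSplit F E c 3).Adelic]
variable [MeasurableSpace (arch F E c 3 ((StdForm.antidiagonal 3).over E))] [BorelSpace (arch F E c 3 ((StdForm.antidiagonal 3).over E))]
variable [MeasurableSpace (finAdelic F E c 3 ((StdForm.antidiagonal 3).over E))] [BorelSpace (finAdelic F E c 3 ((StdForm.antidiagonal 3).over E))]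
variable (νG : Measure (quasiSplit F E c 3).Adelic) [νG.IsHaarMeasure]
variable (μa : Measure (arch F E c 3 ((StdForm.antidiagonal 3).over E))) [μa.IsHaarMeasure] [μa.IsMulRightInvariant]
variable (μf : Measure (finAdelic F E c 3 ((StdForm.antidiagonal 3).over E))) [μf.IsHaarMeasure]

set_option maxHeartbeats 400000 in
include μa μf in
/-- **7b-1_τ CORE — THE GAUGE SYMBOL FROM THE PER-`z` SCALAR LETTER**: let `U₀ ≤ GL₃(𝒪̂_E)` be an open compact subgroup of `GL₃(𝔸_{E,f})` and `V` a space of CONTINUOUS functions on `G(𝔸)`,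
right-invariant under `ι_f(U₀ ∩ G_f)` (`hVU`), in which a function vanishing on `K = val⁻¹(K_∞·GL₃(𝒪̂_E))` vanishes (`hVK`; every space of `(χ₁, χ₂)`-pair-sections, §5).  ASSUME THE
LETTER `h12dCτ`: every pure tensor `h = h_∞ ⊗ 𝟙_{U₀∩G_f} ∈ C_c(G(𝔸))` with `K_∞`-CENTRAL `h_∞` acts on `V ⊗ H^z` by per-`z` scalars (`hten`∕`hcent` in ★ 12d-C's bytes; ★ 12d-C at
`V(χ, K′, ω)`, 12d-C_τ at a pure-`K_∞`-type block).  Then for every `z₀` some gauge test function `η_ψ = α_ψ ⊗ 𝟙_{U₀}` has an ENTIRE symbol `s` on `V` (`∫ S_{η̃}η̃·f_z^φ(x·) = s(z)f_z^φ(x)`)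
with `s(z₀) ≠ 0` and `s` NON-CONSTANT — ★ 7b-1's conclusion with `chiSectionSpace χ K′ ω ↦ V` and ★ 7b-1's proof: §1 for the entire symbol, §2 at a point `k₀ ∈ K` with `φ₀(k₀) ≠ 0`
(`hVK`) for `s(z) = ∫ w·Φ·R^z` with a real weight `w ≥ 0`, `∫ w > 0`, the phase-control neighbourhood (★ `setOf_half_le_re_mem_nhds_one`, ★ `exists_rOut_forall_support_subset`) for
`s(z₀) ≠ 0` (★ `integral_ne_zero_of_re_ge_half`), the `N = 3` archimedean ray (★ `exists_mem_borelHeight_archToAdelic_ne_one_three`) for non-constancy (★ `exists_apply_ne_apply_of_secondDiff`).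
[cite: Bump1997, proof of Lemma 2.3.2] [cite: BernsteinLapid2019, §4 Claim 1] [cite: Langlands1976, §6] -/
theorem exists_gauge_symbol_of_scalars_three
    (U₀ : Subgroup (GL (Fin 3) (FiniteAdeleRing (𝓞 E) E))) (hU₀o : IsOpen (U₀ : Set (GL (Fin 3) (FiniteAdeleRing (𝓞 E) E)))) (hU₀c : IsCompact (U₀ : Set (GL (Fin 3) (FiniteAdeleRing (𝓞 E) E))))
    (hU₀K : U₀ ≤ glFiniteIntegralLevel 3 E)
    {V : Submodule ℂ ((quasiSplit F E c 3).Adelic → ℂ)} (hVc : ∀ φ ∈ V, Continuous φ)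
    (hVU : ∀ φ ∈ V, ∀ b : finAdelic F E c 3 ((StdForm.antidiagonal 3).over E), (b : GL (Fin 3) (FiniteAdeleRing (𝓞 E) E)) ∈ U₀ →
      ∀ y : (quasiSplit F E c 3).Adelic, φ (y * finAdelicToAdelic F E c 3 ((StdForm.antidiagonal 3).over E) b) = φ y)
    (hVK : ∀ φ ∈ V, (∀ k : (quasiSplit F E c 3).Adelic, adelicVal F E c 3 ((StdForm.antidiagonal 3).over E) k ∈ standardMaximalCompactGL 3 E → φ k = 0) → φ = 0)
    (h12dCτ : ∀ (h : (quasiSplit F E c 3).Adelic → ℂ) (hinf : arch F E c 3 ((StdForm.antidiagonal 3).over E) → ℂ), Continuous h → HasCompactSupport h →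
      (∀ y, h y = hinf (archPart F E c 3 _ y) *
        ((U₀.subgroupOf (finAdelic F E c 3 ((StdForm.antidiagonal 3).over E)) : Subgroup _) : Set (finAdelic F E c 3 ((StdForm.antidiagonal 3).over E))).indicator (fun _ => (1 : ℂ)) (finPart F E c 3 _ y)) →
      (∀ k ∈ (((standardMaximalCompactGL 3 E).comap (adelicVal F E c 3 ((StdForm.antidiagonal 3).over E))).comap (archToAdelic F E c 3 ((StdForm.antidiagonal 3).over E))),
        ∀ y, hinf (k⁻¹ * y * k) = hinf y) →
      ∀ z : ℂ, ∃ s : ℂ, ∀ φ ∈ V, ∀ x : (quasiSplit F E c 3).Adelic, ∫ y, h y * flatSectionU φ z (x * y) ∂νG = s * flatSectionU φ z x)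
    (z₀ : ℂ) :
    ∃ ψ : ContDiffBump (0 : ℝ), ∃ s : ℂ → ℂ, Differentiable ℂ s ∧ s z₀ ≠ 0 ∧ (∃ z₁ z₂ : ℂ, s z₁ ≠ s z₂) ∧
      ∀ z : ℂ, ∀ φ ∈ V, ∀ x : (quasiSplit F E c 3).Adelic,
        (∫ y, (fun y : (quasiSplit F E c 3).Adelic => orbitalSmoothing νG
            (fun x : (quasiSplit F E c 3).Adelic => (((adelicWeight U₀ (archBump ψ) (adelicVal F E c 3 ((StdForm.antidiagonal 3).over E) x)) : ℝ) : ℂ))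
            (fun x : (quasiSplit F E c 3).Adelic => (((adelicWeight U₀ (archBump ψ) (adelicVal F E c 3 ((StdForm.antidiagonal 3).over E) x)) : ℝ) : ℂ)) y) y *
          flatSectionU φ z (x * y) ∂νG) = s z * flatSectionU φ z x := by
  by_cases hV : ∃ φ₀ ∈ V, ∃ x₁ : (quasiSplit F E c 3).Adelic, φ₀ x₁ ≠ 0
  swap
  · -- degenerate case: every member of `V` vanishes identically
    push Not at hV
    refine ⟨⟨1, 2, one_pos, one_lt_two⟩, fun z => z - z₀ + 1, (differentiable_id.sub_const z₀).add_const 1, by simp only [sub_self, zero_add, ne_eq, one_ne_zero, not_false_eq_true],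
      ⟨1, 0, fun h => one_ne_zero (by linear_combination h)⟩, fun z φ hφ x => ?_⟩
    have hφ0 : φ = 0 := funext fun y => hV φ hφ y
    subst hφ0
    have h0 : ∀ y, flatSectionU (0 : (quasiSplit F E c 3).Adelic → ℂ) z y = 0 := fun y => by rw [flatSectionU_apply, Pi.zero_apply, zero_mul]
    simp only [h0, mul_zero, integral_zero]
  obtain ⟨φ₀, hφ₀, x₁, hx₁⟩ := hV
  -- a point of `K` where `φ₀` does not vanish (`hVK`)
  obtain ⟨k₀, hk₀K, hk₀⟩ : ∃ k₀ : (quasiSplit F E c 3).Adelic, adelicVal F E c 3 ((StdForm.antidiagonal 3).over E) k₀ ∈ standardMaximalCompactGL 3 E ∧ φ₀ k₀ ≠ 0 := by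
    by_contra hcon
    push Not at hcon
    exact hx₁ (by rw [hVK φ₀ hφ₀ hcon, Pi.zero_apply])
  have hk₀K' : k₀ ∈ (((standardMaximalCompactGL 3 E).comap (adelicVal F E c 3 ((StdForm.antidiagonal 3).over E))) : Subgroup (quasiSplit F E c 3).Adelic) := Subgroup.mem_comap.2 hk₀K
  have hHk₀ : ((borelHeight k₀ : ℝ≥0) : ℝ) = 1 := by rw [borelHeight_eq_one_of_mem hk₀K, NNReal.coe_one]
  -- the phase-control neighbourhood and the bump radius
  have hW := setOf_half_le_re_mem_nhds_one (hVc φ₀ hφ₀) hk₀ z₀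
  obtain ⟨r, hr, hrW⟩ := exists_rOut_forall_support_subset μa hW
  let ψ : ContDiffBump (0 : ℝ) := ⟨r / 2, r, half_pos hr, half_lt_self hr⟩
  have hψr : ψ.rOut = r := rfl
  -- the test function, its pull-back and its self-convolution
  have hηT : IsTestFunctionGL 3 E (adelicWeight U₀ (archBump ψ)) := isTestFunctionGL_gaugeWeight ψ U₀ hU₀o hU₀c
  have hemb : IsClosedEmbedding (adelicVal F E c 3 ((StdForm.antidiagonal 3).over E)) := (isClosed_adelic F E c 3 ((StdForm.antidiagonal 3).over E)).isClosedEmbedding_subtypeVal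
  set ηt : (quasiSplit F E c 3).Adelic → ℂ := fun x => (((adelicWeight U₀ (archBump ψ) (adelicVal F E c 3 ((StdForm.antidiagonal 3).over E) x)) : ℝ) : ℂ) with hηt
  have hηc : Continuous ηt := Complex.continuous_ofReal.comp (hηT.continuous.comp hemb.continuous)
  have hηs : HasCompactSupport ηt := (hηT.hasCompactSupport.comp_isClosedEmbedding hemb).comp_left Complex.ofReal_zero
  set h : (quasiSplit F E c 3).Adelic → ℂ := fun y => orbitalSmoothing νG ηt ηt y with hh
  have hhc : Continuous h := continuous_selfConv νG hηc hηs
  have hhs : HasCompactSupport h := hasCompactSupport_selfConv νG hηs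
  -- the pure-tensor shape (★ 2b) and the letter's binders
  obtain ⟨κ₁, hκ₁, hten⟩ := selfConv_gaugeWeight_eq_pureTensor νG μa μf ψ U₀ hU₀o
  set U : Set (finAdelic F E c 3 ((StdForm.antidiagonal 3).over E)) := ↑(U₀.subgroupOf (finAdelic F E c 3 ((StdForm.antidiagonal 3).over E))) with hUdef
  set αψ : arch F E c 3 ((StdForm.antidiagonal 3).over E) → ℂ := fun x => ((archBump ψ ((x : arch F E c 3 ((StdForm.antidiagonal 3).over E)) : GL (Fin 3) (mixedSpace E)) : ℝ) : ℂ) with hαψ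
  set hinf : arch F E c 3 ((StdForm.antidiagonal 3).over E) → ℂ := fun a => ((κ₁ : ℝ) : ℂ) * (μf.real U : ℂ) * ∫ x, αψ x * αψ (x⁻¹ * a) ∂μa with hhinf
  have hten' : ∀ y, h y = hinf (archPart F E c 3 _ y) * U.indicator (fun _ => (1 : ℂ)) (finPart F E c 3 _ y) := hten
  have hUm : MeasurableSet U := (hU₀o.preimage continuous_subtype_val).measurableSet
  have hUK : ∀ b ∈ U, adelicVal F E c 3 ((StdForm.antidiagonal 3).over E) (finAdelicToAdelic F E c 3 ((StdForm.antidiagonal 3).over E) b) ∈ standardMaximalCompactGL 3 E :=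
    fun b hb => adelicVal_finAdelicToAdelic_mem_of_mem_glFiniteIntegralLevel (hU₀K (Subgroup.mem_subgroupOf.1 hb))
  have hVU' : ∀ φ ∈ V, ∀ b ∈ U, ∀ y : (quasiSplit F E c 3).Adelic, φ (y * finAdelicToAdelic F E c 3 ((StdForm.antidiagonal 3).over E) b) = φ y :=
    fun φ hφ b hb y => hVU φ hφ b (Subgroup.mem_subgroupOf.1 hb) y
  have hcent : ∀ k ∈ (((standardMaximalCompactGL 3 E).comap (adelicVal F E c 3 ((StdForm.antidiagonal 3).over E))).comap (archToAdelic F E c 3 ((StdForm.antidiagonal 3).over E))), ∀ y, hinf (k⁻¹ * y * k) = hinf y :=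
    fun k hk y => archSelfConv_conj μa ψ (((κ₁ : ℝ) : ℂ) * (μf.real U : ℂ)) hk y
  -- THE LETTER: per-`z` scalars; §1: one entire symbol with the action clause; §2: its integral formula at `(φ₀, k₀)`
  have hsc := h12dCτ h hinf hhc hhs hten' hcent
  obtain ⟨s, hsd, hact⟩ := exists_entire_symbol_of_scalars νG hhc hhs hVc hsc
  obtain ⟨κ₂, hκ₂, hform⟩ := symbol_eq_integral_arch_of_rightInvariant νG μa μf hUm hten' hUK hVU' hact hφ₀ hk₀
  -- the phase `Φ`, the ratio `R > 0`, and the REAL weight `w ≥ 0` with `s z = ∫ w·Φ·R^z`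
  set Φ : arch F E c 3 ((StdForm.antidiagonal 3).over E) → ℂ := fun a => φ₀ (k₀ * archToAdelic F E c 3 _ a) / φ₀ k₀ with hΦ
  set R : arch F E c 3 ((StdForm.antidiagonal 3).over E) → ℝ := fun a => ((borelHeight (k₀ * archToAdelic F E c 3 _ a) : ℝ≥0) : ℝ) / ((borelHeight k₀ : ℝ≥0) : ℝ) with hR
  have hRpos : ∀ a, 0 < R a := fun a => ratio_pos k₀ a
  have hΦc : Continuous Φ := continuous_phase (hVc φ₀ hφ₀) k₀
  have hRc : Continuous R := continuous_ratio (F := F) (E := E) (c := c) (N := 3) k₀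
  have hRzc : ∀ z : ℂ, Continuous fun a => (((R a : ℝ)) : ℂ) ^ z := fun z =>
    Continuous.cpow (Complex.continuous_ofReal.comp hRc) continuous_const fun a => Or.inl (by exact_mod_cast hRpos a)
  set w : arch F E c 3 ((StdForm.antidiagonal 3).over E) → ℝ := fun a => ((κ₂ : ℝ) * μf.real U) * (((κ₁ : ℝ) * μf.real U) *
    ∫ x, archBump ψ ((x : arch F E c 3 ((StdForm.antidiagonal 3).over E)) : GL (Fin 3) (mixedSpace E)) * archBump ψ ((x⁻¹ * a : arch F E c 3 ((StdForm.antidiagonal 3).over E)) : GL (Fin 3) (mixedSpace E)) ∂μa) with hw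
  have hhinf_eq : ∀ a, hinf a = ((((κ₁ : ℝ) * μf.real U) * ∫ x, archBump ψ ((x : arch F E c 3 ((StdForm.antidiagonal 3).over E)) : GL (Fin 3) (mixedSpace E)) *
      archBump ψ ((x⁻¹ * a : arch F E c 3 ((StdForm.antidiagonal 3).over E)) : GL (Fin 3) (mixedSpace E)) ∂μa : ℝ) : ℂ) := fun a => by
    simp only [hhinf, hαψ, integral_archBump_mul_eq_ofReal μa ψ a]; push_cast; ring
  have hw_eq : ∀ a, ((w a : ℝ) : ℂ) = ((κ₂ : ℝ) : ℂ) * (μf.real U : ℂ) * hinf a := fun a => by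
    rw [hhinf_eq]; simp only [hw]; push_cast; ring
  have hs_formula : ∀ z : ℂ, s z = ∫ a, ((w a : ℝ) : ℂ) * (Φ a * (((R a : ℝ)) : ℂ) ^ z) ∂μa := fun z => by
    rw [hform z, ← integral_const_mul]
    refine integral_congr_ae (Eventually.of_forall fun a => ?_)
    simp only [hw_eq, hΦ, hR, mul_assoc]
  -- properties of `w`: `≥ 0`, `= κ₂μ_f(U)·Re h(ι ·)` hence continuous, compactly supported, positive integral
  have hw0 : ∀ a, 0 ≤ w a := fun a =>
    mul_nonneg (mul_nonneg κ₂.2 measureReal_nonneg) (mul_nonneg (mul_nonneg κ₁.2 measureReal_nonneg) (integral_archBump_mul_nonneg μa ψ a))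
  have h1U : (1 : finAdelic F E c 3 ((StdForm.antidiagonal 3).over E)) ∈ U := (U₀.subgroupOf (finAdelic F E c 3 ((StdForm.antidiagonal 3).over E))).one_mem
  have hhinf_cont : Continuous hinf := by
    have e : hinf = fun a => h (archToAdelic F E c 3 _ a) := by
      funext a
      rw [hten', archPart_archToAdelic, finPart_archToAdelic, Set.indicator_of_mem h1U, mul_one]
    rw [e]; exact hhc.comp (continuous_archToAdelic F E c 3 _)
  have hwc : Continuous w := by
    have e : w = fun a => (((κ₂ : ℝ) : ℂ) * (μf.real U : ℂ) * hinf a).re := by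
      funext a; rw [← hw_eq, Complex.ofReal_re]
    rw [e]; exact Complex.continuous_re.comp (continuous_const.mul hhinf_cont)
  have hαs : HasCompactSupport αψ := by
    have e : αψ = Complex.ofReal ∘ fun x : arch F E c 3 ((StdForm.antidiagonal 3).over E) => archBump ψ ((x : arch F E c 3 ((StdForm.antidiagonal 3).over E)) : GL (Fin 3) (mixedSpace E)) := rfl
    rw [e]
    exact HasCompactSupport.comp_left (hasCompactSupport_archBump_coe (F := F) (c := c) (N := 3) ψ) Complex.ofReal_zero
  have hw_supp : ∀ a, w a ≠ 0 → (∫ x, αψ x * αψ (x⁻¹ * a) ∂μa) ≠ 0 := by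
    intro a ha h0
    apply ha
    have e := hw_eq a
    simp only [hhinf, h0, mul_zero] at e
    exact_mod_cast e
  have hws : HasCompactSupport w :=
    HasCompactSupport.of_support_subset_isCompact (hαs.isCompact.mul hαs.isCompact) fun a ha => mem_tsupport_mul_of_integral_ne_zero μa ψ (hw_supp a ha)
  have hwi : Integrable w μa := hwc.integrable_of_hasCompactSupport hws
  have hwsC : HasCompactSupport fun a => ((w a : ℝ) : ℂ) := by
    have e : (fun a => ((w a : ℝ) : ℂ)) = Complex.ofReal ∘ w := rfl
    rw [e]; exact HasCompactSupport.comp_left hws Complex.ofReal_zero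
  have hIc : ∀ G : arch F E c 3 ((StdForm.antidiagonal 3).over E) → ℂ, Continuous G → Integrable (fun a => ((w a : ℝ) : ℂ) * G a) μa := fun G hG =>
    ((Complex.continuous_ofReal.comp hwc).mul hG).integrable_of_hasCompactSupport hwsC.mul_right
  have hIr : ∀ G : arch F E c 3 ((StdForm.antidiagonal 3).over E) → ℝ, Continuous G → Integrable (fun a => w a * G a) μa := fun G hG =>
    (hwc.mul hG).integrable_of_hasCompactSupport (hws.mul_right)
  have hUpos : 0 < μf.real U := by
    have hUo : IsOpen U := hU₀o.preimage continuous_subtype_val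
    have hUc : IsCompact U := (isClosed_finAdelic F E c 3 ((StdForm.antidiagonal 3).over E)).isClosedEmbedding_subtypeVal.isCompact_preimage hU₀c
    exact ENNReal.toReal_pos (hUo.measure_ne_zero μf ⟨1, h1U⟩) hUc.measure_lt_top.ne
  have hw1 : w 1 ≠ 0 := ne_of_gt (mul_pos (mul_pos hκ₂ hUpos) (mul_pos (mul_pos hκ₁ hUpos) (integral_archBump_mul_one_pos μa ψ)))
  have hpos : 0 < ∫ a, w a ∂μa := hwc.integral_pos_of_hasCompactSupport_nonneg_nonzero hws hw0 hw1
  -- phase control on the support of `w`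
  have hWmem : ∀ a, w a ≠ 0 → (1 / 2 : ℝ) ≤ (Φ a * (((R a : ℝ)) : ℂ) ^ z₀).re ∧ (1 / 2 : ℝ) ≤ (Φ a).re := fun a ha =>
    hrW ψ (le_of_eq hψr) a (hw_supp a ha)
  -- (1) `s(z₀) ≠ 0`
  have hs0 : s z₀ ≠ 0 := by
    rw [hs_formula z₀]
    exact integral_ne_zero_of_re_ge_half μa hw0 (fun a ha => (hWmem a ha).1) hwi (hIc _ (hΦc.mul (hRzc z₀))) hpos
  -- (2) non-constancy: the set `{w ≠ 0, R ≠ 1}` has positive measure (the arch ray through `k_{0,∞}`)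
  have hch : μa {a | w a ≠ 0 ∧ R a ≠ 1} ≠ 0 := by
    set kinf : arch F E c 3 ((StdForm.antidiagonal 3).over E) := archPart F E c 3 _ k₀ with hkinf
    have hO : {a' : arch F E c 3 ((StdForm.antidiagonal 3).over E) | w (kinf⁻¹ * a' * kinf) ≠ 0} ∈ 𝓝 (1 : arch F E c 3 ((StdForm.antidiagonal 3).over E)) :=
      (isOpen_ne_fun (hwc.comp ((continuous_const.mul continuous_id).mul continuous_const)) continuous_const).mem_nhds
        (by show w (kinf⁻¹ * 1 * kinf) ≠ 0; rwa [mul_one, inv_mul_cancel])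
    obtain ⟨a', ha', hH'⟩ := exists_mem_borelHeight_archToAdelic_ne_one_three hO
    have hR' : R (kinf⁻¹ * a' * kinf) ≠ 1 := by
      have hd : k₀ = archToAdelic F E c 3 _ kinf * finAdelicToAdelic F E c 3 _ (finPart F E c 3 _ k₀) :=
        (archToAdelic_mul_finAdelicToAdelic F E c 3 ((StdForm.antidiagonal 3).over E) k₀).symm
      have hc' : finAdelicToAdelic F E c 3 _ (finPart F E c 3 _ k₀) * archToAdelic F E c 3 _ (kinf⁻¹ * a' * kinf) =
          archToAdelic F E c 3 _ (kinf⁻¹ * a' * kinf) * finAdelicToAdelic F E c 3 _ (finPart F E c 3 _ k₀) :=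
        (commute_archToAdelic_finAdelicToAdelic F E c 3 _ (kinf⁻¹ * a' * kinf) (finPart F E c 3 _ k₀)).eq.symm
      have ek : k₀ * archToAdelic F E c 3 _ (kinf⁻¹ * a' * kinf) = archToAdelic F E c 3 _ a' * k₀ := by
        calc k₀ * archToAdelic F E c 3 _ (kinf⁻¹ * a' * kinf)
            = archToAdelic F E c 3 _ kinf * (finAdelicToAdelic F E c 3 _ (finPart F E c 3 _ k₀) * archToAdelic F E c 3 _ (kinf⁻¹ * a' * kinf)) := by
              conv_lhs => rw [hd]
              rw [mul_assoc]
          _ = archToAdelic F E c 3 _ (kinf * (kinf⁻¹ * a' * kinf)) * finAdelicToAdelic F E c 3 _ (finPart F E c 3 _ k₀) := by rw [hc', ← mul_assoc, ← map_mul]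
          _ = archToAdelic F E c 3 _ (a' * kinf) * finAdelicToAdelic F E c 3 _ (finPart F E c 3 _ k₀) := by
              rw [show kinf * (kinf⁻¹ * a' * kinf) = a' * kinf by group]
          _ = archToAdelic F E c 3 _ a' * k₀ := by rw [map_mul, mul_assoc, ← hd]
      show ((borelHeight (k₀ * archToAdelic F E c 3 _ (kinf⁻¹ * a' * kinf)) : ℝ≥0) : ℝ) / ((borelHeight k₀ : ℝ≥0) : ℝ) ≠ 1
      rw [ek, borelHeight_mul_of_mem_comap_standardMaximalCompactGL hk₀K', hHk₀, div_one, Ne, NNReal.coe_eq_one]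
      exact hH'
    have hmem : kinf⁻¹ * a' * kinf ∈ ({a | w a ≠ 0} ∩ {a | R a ≠ 1} : Set (arch F E c 3 ((StdForm.antidiagonal 3).over E))) := ⟨ha', hR'⟩
    rw [Set.setOf_and]
    exact ((isOpen_ne_fun hwc continuous_const).inter (isOpen_ne_fun hRc continuous_const)).measure_ne_zero μa ⟨_, hmem⟩
  have hnc : ∃ z₁ z₂ : ℂ, s z₁ ≠ s z₂ := by
    refine exists_apply_ne_apply_of_secondDiff μa hw0 hRpos (fun a ha => (hWmem a ha).2) 0 (s := s) (fun z _ => ?_) (hIc _ (hΦc.mul (hRzc _)))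
      (hIc _ (hΦc.mul (hRzc _))) (hIc _ (hΦc.mul (hRzc _))) (hIr _ ?_) (hIc _ (hΦc.mul ((hRzc _).mul ((Complex.continuous_ofReal.comp hRc).sub continuous_const |>.pow 2)))) hch
    · exact hs_formula z
    · exact (hRc.rpow_const fun a => Or.inl (hRpos a).ne').mul ((hRc.sub continuous_const).pow 2)
  refine ⟨ψ, s, hsd, hs0, hnc, fun z φ hφ x => ?_⟩
  have e := hact z φ hφ x
  simp only [hh, hηt] at e
  exact e

end Core

end Summit.HodgeConjecture.HodgeConjecture.Cruxes.H413.K2E1ChiGaugeSymbolTauU3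

end
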